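import Mathlib.Analysis.InnerProductSpace.PiL2
import Mathlib.Analysis.Normed.Module.FiniteDimension
import Mathlib.Topology.Order.Lattice
import HarnessLib

/-!
# Minimal distance `ψ`, the Tammes number `d_N`, maximal arrangements and shifts
# (Musin–Tarasov 2012, §1.2, §2.1, Proposition 3.2 — the shift half) — proved

Topic `Literature/Geometry/DiscreteGeometry`; brick 2, in printed order, of the proof of Theorem 1
of O. R. Musin, A. S. Tarasov, *The strong thirteen spheres problem*, Discrete Comput. Geom. 48
(2012) 128–141 [`MusinTarasov2012`] (named fact `musinTarasov2012_tammes_thirteen` of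
`TammesThirteen.lean`; brick 1 is `SphericalCodeContactGraph.lean`: Propositions 3.1, 3.3, 3.6,
3.7).  Everything here is a definition or PROVED; no named facts; no inner products are used, so
the ambient space is any real normed space `E` (the sphere `S^{n-1}` being the case
`E = EuclideanSpace ℝ (Fin n)`), and Part A any metric space.

## Source (verbatim, arXiv:1002.1439v3)

* §1.2: "a finite subset `X` of `S^{n−1}` is called a spherical `ψ`-code if for every pair `(x, y)`
  of `X` with `x ≠ y` its angular distance `dist(x, y)` is at least `ψ`.  Let `X` be a finite
  subset of `S²`. Denote `ψ(X) := min_{x,y ∈ X} {dist(x, y)}`, where `x ≠ y`. […] Denote by `d_N`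
  the largest angular separation `ψ(X)` with `|X| = N` that can be attained in `S²`, i.e.
  `d_N := max_{X ⊂ S²} {ψ(X)}`, where `|X| = N`."
* §2.1: "**Contact graphs.** […] The contact graph `CG(X)` is the graph with vertices in `X` and
  edges `(x, y)`, `x, y ∈ X` such that `dist(x, y) = ψ(X)`.  **Shift of a single vertex.** […] Let
  `x ∈ X` be a vertex of `CG(X)` with `deg(x) > 0` […]. We say that there exists a shift of `x` if
  `x` can be slightly shifted to `x′` such that `dist(x′, X ∖ {x}) > ψ(X)`.  […] **Irreducible
  graphs.** We say that the graph `CG(X)` is irreducible (or jammed) if there are neither Danzer's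
  flips nor shifts of vertices.  […] **Maximal graphs `G₁₃`.** Let `X` be a subset of `S²` with
  `|X| = 13` and `ψ(X) = d₁₃`. Denote by `G₁₃` the graph `CG(X)`."
* "**Proposition 3.2.** Let `X` be a subset of `S²` with `|X| = N` and `ψ(X) = d_N`. Then for
  `N > 6` the graph `CG(X)` is irreducible." (quoted from Danzer 1986).

## What is proved, and in which form

Configurations are LABELLED, `x : Fin N → E` (a finite set `X` of `N` points is any injective
`x`; `exists_finset_of_le_minDist` / `exists_dist_le_maxMinDist` pass between the two), and
distances are chordal (`‖x i − x j‖ = 2 sin(∠/2)`, a monotone reparametrisation of the angular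
distance of the paper on `[0, π]`).

* Part A (any metric space): `minDist x` = `ψ(x)` (`min_{i ≠ j} dist`, `0` for `N ≤ 1`), with
  `minDist_le_dist`, `le_minDist(_iff)`, `exists_dist_eq_minDist` (attained),
  `minDist_pos_iff` (positive iff injective), `continuous_minDist`.
* Part B (real normed space `E`): `unitConfigs N E` (compact: `isCompact_unitConfigs`),
  **maximal arrangements exist** (`exists_isMaxOn_minDist` — the "max" in the definition of
  `d_N`), `maxMinDist N E` = **`d_N` (chordal)** with `minDist_le_maxMinDist` (every
  configuration), `exists_minDist_eq_maxMinDist` (attained), `0 ≤ d_N ≤ 2`, and the finite-set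
  reading `exists_dist_le_maxMinDist`: any `N ≥ 2` distinct unit vectors contain two at distance
  `≤ d_N`.  (The companion `TammesThirteenOptimal.lean` proves
  `musinTarasov2012_tammes_thirteen ↔ d₁₃ < 0.957` and `d₁₃ ≥ 0.9564136`.)
* Part C: `contactPairs x` (ordered pairs at distance `ψ(x)` = the darts of `CG(x)`),
  `HasShift x i` — the shift of §2.1 in RELOCATION form (a unit vector `y` with
  `dist(y, x j) > ψ(x)` for all `j ≠ i`; "slightly" is dropped, which only strengthens the
  non-existence statements proved), `IsTammesOptimal N E x` — **a maximal arrangement with the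
  minimal number of contact pairs** (the arrangements the printed proof works with),
  `exists_isTammesOptimal`, and **Proposition 3.2, shift half**:
  `IsTammesOptimal.not_hasShift` — no vertex of positive degree of such an arrangement admits a
  shift (moving it would keep `ψ` by maximality and strictly decrease the number of contact
  pairs).  Valid for all `N` and `E`.

Not here (next bricks): Danzer flips and the flip half of Proposition 3.2 (`N > 6`: degree-1 and
degree-2 vertices are shiftable when `d_N < 90°`, and a flip at degree `≥ 3` loses an edge);
faces; §§4–5.

## References

* O. R. Musin, A. S. Tarasov, *The strong thirteen spheres problem*, Discrete Comput. Geom. 48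
  (2012) 128–141, doi:10.1007/s00454-011-9392-2 = arXiv:1002.1439: §1.2, §2.1, Proposition 3.2.
  [`MusinTarasov2012`]
* L. Danzer, *Finite point-sets on `S²` with minimum distance as large as possible*, Discrete
  Math. 60 (1986) 3–66 (Proposition 3.2 is quoted from there).
-/

noncomputable section

namespace Literature.Geometry.DiscreteGeometry

open Finset

/-! ### Part A. The minimal distance `ψ(x)` of a configuration -/

section MinDist

variable {α : Type*} [MetricSpace α] {N : ℕ}

/-- The ordered pairs of distinct indices. [folklore] -/
abbrev distinctPairs (N : ℕ) : Finset (Fin N × Fin N) := (Finset.univ : Finset (Fin N)).offDiag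

/-- Membership in `distinctPairs`. [folklore] -/
theorem mem_distinctPairs {p : Fin N × Fin N} : p ∈ distinctPairs N ↔ p.1 ≠ p.2 := by
  simp [Finset.mem_offDiag]

/-- There is a pair of distinct labels as soon as two labels differ (`N ≥ 2`). [folklore] -/
theorem distinctPairs_nonempty {i j : Fin N} (hij : i ≠ j) : (distinctPairs N).Nonempty :=
  ⟨(i, j), mem_distinctPairs.2 hij⟩

/-- **`ψ(x)`, the minimal distance of a configuration** `x : Fin N → α` of `N` labelled points of
a metric space: `min_{i ≠ j} dist (x i) (x j)` (and `0` when `N ≤ 1`).  For points of `S²` with the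
chordal metric of `ℝ³` this is `2 sin (ψ(X)/2)` for Musin–Tarasov's angular
`ψ(X) = min_{x ≠ y} dist(x, y)`; it vanishes iff two labels carry the same point.
[cite: MusinTarasov2012, §1.2 (definition of ψ(X))] -/
def minDist (x : Fin N → α) : ℝ :=
  if h : (distinctPairs N).Nonempty then (distinctPairs N).inf' h (fun p => dist (x p.1) (x p.2))
  else 0

/-- Unfolding `ψ` for `N ≥ 2`. [cite: MusinTarasov2012, §1.2 (definition of ψ(X))] -/
theorem minDist_eq_inf' (x : Fin N → α) (h : (distinctPairs N).Nonempty) :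
    minDist x = (distinctPairs N).inf' h (fun p => dist (x p.1) (x p.2)) := by
  rw [minDist, dif_pos h]

/-- `ψ(x) ≤ dist (x i) (x j)` for `i ≠ j`. [cite: MusinTarasov2012, §1.2] -/
theorem minDist_le_dist (x : Fin N → α) {i j : Fin N} (hij : i ≠ j) :
    minDist x ≤ dist (x i) (x j) := by
  rw [minDist_eq_inf' x (distinctPairs_nonempty hij)]
  exact Finset.inf'_le _ (mem_distinctPairs.2 hij : (i, j) ∈ distinctPairs N)

/-- A lower bound for all distances of distinct labels is a lower bound for `ψ` (`N ≥ 2`).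
[cite: MusinTarasov2012, §1.2] -/
theorem le_minDist (x : Fin N → α) (h : (distinctPairs N).Nonempty) {m : ℝ}
    (hm : ∀ i j, i ≠ j → m ≤ dist (x i) (x j)) : m ≤ minDist x := by
  rw [minDist_eq_inf' x h]
  exact Finset.le_inf' _ _ fun p hp => hm p.1 p.2 (mem_distinctPairs.1 hp)

/-- `m ≤ ψ(x)` iff all distances of distinct labels are `≥ m` (`N ≥ 2`).
[cite: MusinTarasov2012, §1.2] -/
theorem le_minDist_iff (x : Fin N → α) (h : (distinctPairs N).Nonempty) {m : ℝ} :
    m ≤ minDist x ↔ ∀ i j, i ≠ j → m ≤ dist (x i) (x j) :=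
  ⟨fun hm _ _ hij => hm.trans (minDist_le_dist x hij), le_minDist x h⟩

/-- The minimal distance is attained (`N ≥ 2`). [cite: MusinTarasov2012, §1.2] -/
theorem exists_dist_eq_minDist (x : Fin N → α) (h : (distinctPairs N).Nonempty) :
    ∃ i j, i ≠ j ∧ dist (x i) (x j) = minDist x := by
  obtain ⟨p, hp, hpe⟩ := Finset.exists_mem_eq_inf' h (fun p => dist (x p.1) (x p.2))
  exact ⟨p.1, p.2, mem_distinctPairs.1 hp, by rw [minDist_eq_inf' x h, hpe]⟩

/-- The degenerate case `N ≤ 1`: `ψ = 0` by convention. [folklore] -/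
theorem minDist_of_not_nonempty (x : Fin N → α) (h : ¬ (distinctPairs N).Nonempty) :
    minDist x = 0 := by
  rw [minDist, dif_neg h]

/-- `ψ(x) ≥ 0`. [folklore] -/
theorem minDist_nonneg (x : Fin N → α) : 0 ≤ minDist x := by
  by_cases h : (distinctPairs N).Nonempty
  · exact le_minDist x h fun _ _ _ => dist_nonneg
  · rw [minDist_of_not_nonempty x h]

/-- `ψ(x) > 0` iff the labelled points are pairwise distinct (`N ≥ 2`). [folklore] -/
theorem minDist_pos_iff (x : Fin N → α) (h : (distinctPairs N).Nonempty) :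
    0 < minDist x ↔ Function.Injective x := by
  constructor
  · intro hpos i j hij
    by_contra hne
    have := minDist_le_dist x hne
    rw [hij, dist_self] at this
    exact absurd this (not_le.2 hpos)
  · intro hinj
    obtain ⟨i, j, hij, he⟩ := exists_dist_eq_minDist x h
    rw [← he]
    exact dist_pos.2 (hinj.ne hij)

/-- **`ψ` is continuous** in the configuration (a finite minimum of continuous functions).
[folklore] -/
theorem continuous_minDist : Continuous (fun x : Fin N → α => minDist x) := by
  by_cases h : (distinctPairs N).Nonempty
  · have : (fun x : Fin N → α => minDist x) =
        fun x => (distinctPairs N).inf' h (fun p => dist (x p.1) (x p.2)) := by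
      funext x; exact minDist_eq_inf' x h
    rw [this]
    exact Continuous.finset_inf'_apply h fun p _ =>
      ((continuous_apply p.1).dist (continuous_apply p.2))
  · have : (fun x : Fin N → α => minDist x) = fun _ => 0 := by
      funext x; exact minDist_of_not_nonempty x h
    rw [this]
    exact continuous_const

end MinDist

/-! ### Part B. Unit configurations, maximal arrangements, and the Tammes number `d_N` -/

section Sphere

variable {E : Type*} [NormedAddCommGroup E] {N : ℕ}

/-- The configurations of `N` labelled points of the unit sphere of `E`.
[cite: MusinTarasov2012, §1.2] -/
def unitConfigs (N : ℕ) (E : Type*) [NormedAddCommGroup E] : Set (Fin N → E) :=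
  {x | ∀ i, ‖x i‖ = 1}

/-- Membership in `unitConfigs`. [cite: MusinTarasov2012, §1.2] -/
theorem mem_unitConfigs {x : Fin N → E} : x ∈ unitConfigs N E ↔ ∀ i, ‖x i‖ = 1 := Iff.rfl

/-- `unitConfigs` is the product of `N` unit spheres. [folklore] -/
theorem unitConfigs_eq_pi :
    unitConfigs N E = Set.univ.pi (fun _ : Fin N => Metric.sphere (0 : E) 1) := by
  ext x
  simp [unitConfigs]

/-- The space of `N`-point configurations of the sphere is compact (finite-dimensional `E`).
[folklore] -/
theorem isCompact_unitConfigs [NormedSpace ℝ E] [FiniteDimensional ℝ E] :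
    IsCompact (unitConfigs N E) := by
  rw [unitConfigs_eq_pi]
  exact isCompact_univ_pi fun _ => isCompact_sphere 0 1

/-- It is nonempty (as soon as `E ≠ 0`). [folklore] -/
theorem unitConfigs_nonempty [NormedSpace ℝ E] [Nontrivial E] : (unitConfigs N E).Nonempty := by
  obtain ⟨v, hv⟩ := exists_norm_eq E zero_le_one
  exact ⟨fun _ => v, fun _ => hv⟩

/-- Distances on the unit sphere are `≤ 2`, hence so is `ψ`. [folklore] -/
theorem minDist_le_two {x : Fin N → E} (hx : x ∈ unitConfigs N E) : minDist x ≤ 2 := by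
  by_cases h : (distinctPairs N).Nonempty
  · obtain ⟨p, hp⟩ := h
    have hp' := mem_distinctPairs.1 hp
    calc minDist x ≤ dist (x p.1) (x p.2) := minDist_le_dist x hp'
      _ ≤ ‖x p.1‖ + ‖x p.2‖ := by rw [dist_eq_norm]; exact norm_sub_le _ _
      _ = 2 := by rw [hx p.1, hx p.2]; norm_num
  · rw [minDist_of_not_nonempty x h]; norm_num

/-- **Maximal arrangements exist**: `ψ` attains its maximum on the compact configuration space
(the "`max`" in Musin–Tarasov's `d_N := max_{X ⊂ S², |X| = N} ψ(X)`).
[cite: MusinTarasov2012, §1.2 (definition of d_N)] -/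
theorem exists_isMaxOn_minDist [NormedSpace ℝ E] [FiniteDimensional ℝ E] [Nontrivial E] (N : ℕ) :
    ∃ x ∈ unitConfigs N E, IsMaxOn minDist (unitConfigs N E) x :=
  isCompact_unitConfigs.exists_isMaxOn unitConfigs_nonempty continuous_minDist.continuousOn

/-- **The Tammes number `d_N` (chordal form)**: the largest minimal distance of `N` points of the
unit sphere of `E`, `sup_x ψ(x)` — a maximum by `exists_minDist_eq_maxMinDist`.  For `E = ℝ³` this
is `2 sin (d_N/2)` for Musin–Tarasov's angular `d_N := max_{|X| = N} ψ(X)` ("how are `N`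
congruent, not overlapping circles distributed on the sphere when their common radius has to be
as large as possible?"). [cite: MusinTarasov2012, §1.2 (definition of d_N)] -/
def maxMinDist (N : ℕ) (E : Type*) [NormedAddCommGroup E] : ℝ :=
  sSup ((fun x => minDist x) '' unitConfigs N E)

/-- The values of `ψ` on unit configurations are bounded above (by `2`). [folklore] -/
theorem bddAbove_minDist_image : BddAbove ((fun x => minDist x) '' unitConfigs N E) :=
  ⟨2, by rintro _ ⟨x, hx, rfl⟩; exact minDist_le_two hx⟩

/-- `ψ(x) ≤ d_N` for every configuration of the unit sphere. [cite: MusinTarasov2012, §1.2] -/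
theorem minDist_le_maxMinDist {x : Fin N → E} (hx : x ∈ unitConfigs N E) :
    minDist x ≤ maxMinDist N E :=
  le_csSup bddAbove_minDist_image ⟨x, hx, rfl⟩

/-- A maximal arrangement realises `d_N`. [cite: MusinTarasov2012, §1.2] -/
theorem minDist_eq_maxMinDist_of_isMaxOn {x : Fin N → E} (hx : x ∈ unitConfigs N E)
    (hmax : IsMaxOn minDist (unitConfigs N E) x) : minDist x = maxMinDist N E := by
  refine le_antisymm (minDist_le_maxMinDist hx) (csSup_le ⟨_, x, hx, rfl⟩ ?_)
  rintro _ ⟨y, hy, rfl⟩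
  exact hmax hy

/-- **`d_N` is attained** (finite-dimensional `E ≠ 0`). [cite: MusinTarasov2012, §1.2] -/
theorem exists_minDist_eq_maxMinDist [NormedSpace ℝ E] [FiniteDimensional ℝ E] [Nontrivial E]
    (N : ℕ) :
    ∃ x ∈ unitConfigs N E, minDist x = maxMinDist N E := by
  obtain ⟨x, hx, hmax⟩ := exists_isMaxOn_minDist (E := E) N
  exact ⟨x, hx, minDist_eq_maxMinDist_of_isMaxOn hx hmax⟩

/-- `0 ≤ d_N`. [folklore] -/
theorem maxMinDist_nonneg [NormedSpace ℝ E] [Nontrivial E] : 0 ≤ maxMinDist N E := by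
  obtain ⟨x, hx⟩ := unitConfigs_nonempty (N := N) (E := E)
  exact (minDist_nonneg x).trans (minDist_le_maxMinDist hx)

/-- `d_N ≤ 2`. [folklore] -/
theorem maxMinDist_le_two [NormedSpace ℝ E] [Nontrivial E] : maxMinDist N E ≤ 2 :=
  csSup_le (unitConfigs_nonempty.image _) (by rintro _ ⟨x, hx, rfl⟩; exact minDist_le_two hx)

/-- **Finite-set reading of `d_N`.**  Any `N` distinct points of the unit sphere (a `Finset` of
cardinal `N ≥ 2`) contain two at distance `≤ d_N`. [cite: MusinTarasov2012, §1.2] -/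
theorem exists_dist_le_maxMinDist {T : Finset E} (hT : ∀ v ∈ T, ‖v‖ = 1) (h2 : 2 ≤ T.card) :
    ∃ v ∈ T, ∃ w ∈ T, v ≠ w ∧ dist v w ≤ maxMinDist T.card E := by
  set x : Fin T.card → E := fun i => (T.equivFin.symm i : E) with hxdef
  have hx : x ∈ unitConfigs T.card E := fun i => hT _ (T.equivFin.symm i).2
  have hne : (distinctPairs T.card).Nonempty := by
    refine distinctPairs_nonempty (i := ⟨0, by omega⟩) (j := ⟨1, by omega⟩) ?_
    simp
  obtain ⟨i, j, hij, he⟩ := exists_dist_eq_minDist x hne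
  refine ⟨x i, (T.equivFin.symm i).2, x j, (T.equivFin.symm j).2, ?_, ?_⟩
  · intro h
    exact hij (T.equivFin.symm.injective (Subtype.val_injective h))
  · rw [he]; exact minDist_le_maxMinDist hx

/-- Conversely a configuration with `ψ(x) ≥ m > 0` is injective, so its image is a `Finset` of
cardinal `N` with pairwise distances `≥ m`. [folklore] -/
theorem exists_finset_of_le_minDist {x : Fin N → E} (hx : x ∈ unitConfigs N E)
    (hne : (distinctPairs N).Nonempty) {m : ℝ} (hm0 : 0 < m) (hm : m ≤ minDist x) :
    ∃ T : Finset E, T.card = N ∧ (∀ v ∈ T, ‖v‖ = 1) ∧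
      ∀ v ∈ T, ∀ w ∈ T, v ≠ w → m ≤ dist v w := by
  classical
  have hinj : Function.Injective x := (minDist_pos_iff x hne).1 (hm0.trans_le hm)
  refine ⟨Finset.univ.image x, ?_, ?_, ?_⟩
  · rw [Finset.card_image_of_injective _ hinj, Finset.card_univ, Fintype.card_fin]
  · simp only [Finset.mem_image, Finset.mem_univ, true_and, forall_exists_index]
    rintro _ i rfl
    exact hx i
  · simp only [Finset.mem_image, Finset.mem_univ, true_and, forall_exists_index]
    rintro _ i rfl _ j rfl hij
    exact hm.trans (minDist_le_dist x fun h => hij (by rw [h]))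

end Sphere

/-! ### Part C. Contact pairs, shifts, and maximal arrangements with the fewest edges
(§2.1 and Proposition 3.2, the shift half) -/

section Shift

variable {α : Type*} [MetricSpace α] {N : ℕ}

/-- **The contact pairs of a configuration**: the ordered pairs of distinct labels at distance
exactly `ψ(x)` — the (oriented) edges of the contact graph `CG(x)`, so that
`(contactPairs x).card` is twice the number of edges.
[cite: MusinTarasov2012, §2.1 (Contact graphs)] -/
def contactPairs (x : Fin N → α) : Finset (Fin N × Fin N) :=
  (distinctPairs N).filter (fun p => dist (x p.1) (x p.2) = minDist x)

/-- Membership in `contactPairs`: distinct labels at distance `ψ(x)`.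
[cite: MusinTarasov2012, §2.1 (Contact graphs)] -/
theorem mem_contactPairs {x : Fin N → α} {p : Fin N × Fin N} :
    p ∈ contactPairs x ↔ p.1 ≠ p.2 ∧ dist (x p.1) (x p.2) = minDist x := by
  simp [contactPairs, Finset.mem_filter, Finset.mem_offDiag]

/-- Contact is symmetric. [folklore] -/
theorem swap_mem_contactPairs {x : Fin N → α} {p : Fin N × Fin N} (hp : p ∈ contactPairs x) :
    p.swap ∈ contactPairs x := by
  rw [mem_contactPairs] at hp ⊢
  exact ⟨hp.1.symm, by rw [Prod.fst_swap, Prod.snd_swap, dist_comm]; exact hp.2⟩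

/-- For `N ≥ 2` some pair is in contact. [cite: MusinTarasov2012, §2.1] -/
theorem contactPairs_nonempty (x : Fin N → α) (h : (distinctPairs N).Nonempty) :
    (contactPairs x).Nonempty := by
  obtain ⟨i, j, hij, he⟩ := exists_dist_eq_minDist x h
  exact ⟨(i, j), mem_contactPairs.2 ⟨hij, he⟩⟩

end Shift

section ShiftSphere

variable {E : Type*} [NormedAddCommGroup E] {N : ℕ}

/-- **Shift of a single vertex** (Musin–Tarasov, §2.1: "We say that there exists a shift of `x` if
`x` can be slightly shifted to `x′` such that `dist(x′, X ∖ {x}) > ψ(X)`").  Here in the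
RELOCATION form: label `i` of the unit configuration `x` admits a shift if there is a point `y` of
the unit sphere with `dist (y, x j) > ψ(x)` for all `j ≠ i` — the word "slightly" is dropped, which
makes `HasShift` weaker to assume and `¬ HasShift` (irreducibility) stronger to conclude; the
existence statement of Proposition 3.2 below is proved for this stronger irreducibility, and every
shift constructed in the printed proofs of Propositions 3.3–3.5 is in particular a relocation.
[cite: MusinTarasov2012, §2.1 (Shift of a single vertex)] -/
def HasShift (x : Fin N → E) (i : Fin N) : Prop :=
  ∃ y : E, ‖y‖ = 1 ∧ ∀ j, j ≠ i → minDist x < dist y (x j)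

/-- **A maximal arrangement with the minimal number of edges** — the configurations to which the
printed proof applies Danzer's irreducibility (Proposition 3.2 is quoted from Danzer for maximal
arrangements; Böröczky–Szabó and the enumeration of §4 use a maximal arrangement minimising the
number of contact edges): `x` is a unit configuration maximising `ψ`, and among those it
minimises the number of contact pairs. [cite: MusinTarasov2012, §2.1 (Maximal graphs G₁₃) and
Proposition 3.2] -/
def IsTammesOptimal (N : ℕ) (E : Type*) [NormedAddCommGroup E] (x : Fin N → E) : Prop :=
  x ∈ unitConfigs N E ∧ IsMaxOn minDist (unitConfigs N E) x ∧
    ∀ y ∈ unitConfigs N E, minDist y = minDist x → (contactPairs x).card ≤ (contactPairs y).card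

/-- An optimal arrangement is a unit configuration. [cite: MusinTarasov2012, §2.1] -/
theorem IsTammesOptimal.mem {x : Fin N → E} (h : IsTammesOptimal N E x) : x ∈ unitConfigs N E := h.1

/-- … maximising `ψ` … [cite: MusinTarasov2012, §2.1 (Maximal graphs)] -/
theorem IsTammesOptimal.isMaxOn {x : Fin N → E} (h : IsTammesOptimal N E x) :
    IsMaxOn minDist (unitConfigs N E) x := h.2.1

/-- … so that `ψ(x) = d_N` … [cite: MusinTarasov2012, §2.1 (Maximal graphs: ψ(X) = d_N)] -/
theorem IsTammesOptimal.minDist_eq {x : Fin N → E} (h : IsTammesOptimal N E x) :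
    minDist x = maxMinDist N E := minDist_eq_maxMinDist_of_isMaxOn h.1 h.2.1

/-- … and minimising the number of contact pairs among the maximisers.
[cite: MusinTarasov2012, Proposition 3.2] -/
theorem IsTammesOptimal.card_le {x : Fin N → E} (h : IsTammesOptimal N E x) {y : Fin N → E}
    (hy : y ∈ unitConfigs N E) (he : minDist y = minDist x) :
    (contactPairs x).card ≤ (contactPairs y).card := h.2.2 y hy he

/-- **Maximal arrangements with the fewest edges exist** (finite-dimensional `E ≠ 0`): maximise
`ψ` on the compact configuration space, then minimise the (natural) number of contact pairs among
the maximisers. [cite: MusinTarasov2012, §2.1 and Proposition 3.2] -/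
theorem exists_isTammesOptimal [NormedSpace ℝ E] [FiniteDimensional ℝ E] [Nontrivial E] (N : ℕ) :
    ∃ x : Fin N → E, IsTammesOptimal N E x := by
  classical
  -- the set of maximisers is nonempty; minimise the number of contact pairs over it
  have hex : ∃ n, ∃ x ∈ unitConfigs N E, IsMaxOn minDist (unitConfigs N E) x ∧
      (contactPairs x).card = n := by
    obtain ⟨x, hx, hmax⟩ := exists_isMaxOn_minDist (E := E) N
    exact ⟨_, x, hx, hmax, rfl⟩
  obtain ⟨x, hx, hmax, hcard⟩ := Nat.find_spec hex
  refine ⟨x, hx, hmax, fun y hy he => ?_⟩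
  have hymax : IsMaxOn minDist (unitConfigs N E) y := fun z hz => by
    show minDist z ≤ minDist y
    rw [he]; exact hmax hz
  rw [hcard]
  exact Nat.find_min' hex ⟨y, hy, hymax, rfl⟩

/-- Replacing one point of a unit configuration by a unit vector gives a unit configuration.
[folklore] -/
theorem update_mem_unitConfigs {x : Fin N → E} (hx : x ∈ unitConfigs N E) (i : Fin N) {y : E}
    (hy : ‖y‖ = 1) : Function.update x i y ∈ unitConfigs N E := by
  intro j
  by_cases hji : j = i
  · subst hji; simp [hy]
  · rw [Function.update_of_ne hji]; exact hx j

/-- **Proposition 3.2, the shift half: in a maximal arrangement with the fewest edges no vertex of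
positive degree admits a shift.**  (Musin–Tarasov quote Proposition 3.2 — "Let `X ⊂ S²` with
`|X| = N` and `ψ(X) = d_N`. Then for `N > 6` the graph `CG(X)` is irreducible" — from Danzer;
irreducible = no shifts and no Danzer flips.  The shift part, for the edge-minimising maximal
arrangements used in the sequel, is the following counting argument, valid for every `N` and
every `E`: moving the vertex `x i` of positive degree to a position `y` at distance `> ψ` from all
other points gives a unit configuration `x′` with `ψ(x′) ≥ ψ(x)`, hence `ψ(x′) = ψ(x)` by
maximality, whose contact pairs are those of `x` not involving `i` — strictly fewer, contradicting
minimality.  The Danzer-flip part and the restriction `N > 6` belong to the next brick.)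
[cite: MusinTarasov2012, Proposition 3.2] -/
theorem IsTammesOptimal.not_hasShift {x : Fin N → E} (hopt : IsTammesOptimal N E x) {i : Fin N}
    (hdeg : ∃ j, (i, j) ∈ contactPairs x) : ¬ HasShift x i := by
  classical
  rintro ⟨y, hy1, hy⟩
  obtain ⟨j, hj⟩ := hdeg
  have hij : i ≠ j := (mem_contactPairs.1 hj).1
  have hne : (distinctPairs N).Nonempty := distinctPairs_nonempty hij
  set x' : Fin N → E := Function.update x i y with hx'def
  have hx' : x' ∈ unitConfigs N E := update_mem_unitConfigs hopt.mem i hy1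
  have hx'i : x' i = y := by simp [hx'def]
  have hx'j : ∀ k, k ≠ i → x' k = x k := fun k hk => by simp [hx'def, Function.update_of_ne hk]
  -- `ψ(x') = ψ(x)`
  have hge : minDist x ≤ minDist x' := by
    refine le_minDist x' hne fun p q hpq => ?_
    by_cases hp : p = i
    · subst hp
      rw [hx'i, hx'j q (Ne.symm hpq)]
      exact (hy q (Ne.symm hpq)).le
    by_cases hq : q = i
    · subst hq
      rw [hx'i, hx'j p hp, dist_comm]
      exact (hy p hp).le
    rw [hx'j p hp, hx'j q hq]
    exact minDist_le_dist x hpq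
  have heq : minDist x' = minDist x := le_antisymm (hopt.isMaxOn hx') hge
  -- the contact pairs of `x'` are contact pairs of `x` avoiding `i`
  have hsub : contactPairs x' ⊆ contactPairs x := by
    intro p hp
    obtain ⟨hpne, hpd⟩ := mem_contactPairs.1 hp
    rw [heq] at hpd
    have hp1 : p.1 ≠ i := by
      intro h1
      rw [h1, hx'i] at hpd
      have h2 : p.2 ≠ i := fun h2 => hpne (h1.trans h2.symm)
      rw [hx'j p.2 h2] at hpd
      exact absurd hpd (ne_of_gt (hy p.2 h2))
    have hp2 : p.2 ≠ i := by
      intro h2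
      rw [h2, hx'i, hx'j p.1 hp1, dist_comm] at hpd
      exact absurd hpd (ne_of_gt (hy p.1 hp1))
    rw [hx'j p.1 hp1, hx'j p.2 hp2] at hpd
    exact mem_contactPairs.2 ⟨hpne, hpd⟩
  have hnot : (i, j) ∉ contactPairs x' := by
    intro h
    obtain ⟨-, hd⟩ := mem_contactPairs.1 h
    rw [heq] at hd
    simp only at hd
    rw [hx'i, hx'j j hij.symm] at hd
    exact absurd hd (ne_of_gt (hy j hij.symm))
  have hlt : (contactPairs x').card < (contactPairs x).card :=
    Finset.card_lt_card ⟨hsub, fun h => hnot (h hj)⟩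
  exact absurd (hopt.card_le hx' heq) (not_le.2 hlt)

/-- In particular a maximal arrangement with the fewest edges is **jammed against relocation**:
no point in contact with another can be moved anywhere on the sphere so as to lose all its
contacts (isolated points — the "rattlers" of §3 — may of course move).
[cite: MusinTarasov2012, Proposition 3.2] -/
theorem IsTammesOptimal.forall_not_hasShift {x : Fin N → E} (hopt : IsTammesOptimal N E x) :
    ∀ i, (∃ j, (i, j) ∈ contactPairs x) → ¬ HasShift x i := fun _ hdeg =>
  hopt.not_hasShift hdeg

end ShiftSphere

end Literature.Geometry.DiscreteGeometry

end
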